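import Mathlib
import HarnessLib
import Summits.ResolutionOfSingularities.ResolutionOfSingularities.Theorems.WildQuotientsWildQuotientResolutionBlowupExitBasicOpenSections
import Summits.ResolutionOfSingularities.ResolutionOfSingularities.Theorems.WildQuotientsWildQuotientResolutionJordanFiveFrameDefs

/-!
# RUNG V5 (`J₅`), W-side kit: stability, affineness and the seam for ANY invariant Rees chart
# `D₊(s)` of `Bl_{I₁₂} 𝔸ⁿ`
(crux stmt-ResolutionOfSingularities-15640 `WildQuotients.WildQuotientResolution`, line `Sketch`;
chain w45c RUNG V5 `JordanFive.jordanFive_hasResolution_of_bricks` (res-L1-w45c-lead-1 BRICK LIST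
v1, `stubs/J5Bricks.lean` 10:32:12Z), res-L1-w45c-plan-1 RULING 10:50Z «stub-5 = (δ1) W-SIDE
PACKAGE»; written by res-D-pv-033 AS res-L1-w45c-stub-5. [OURS · L1 W4.5c] — assembly of landed
generic decls (p503738 `ToricExit.preimage_basicOpen_liftAction_of_monomial`, p510259
`BlowupExit.exists_reesGradedHom_family` / `exists_basicOpen_sectionsEquiv` /
`mem_invariantsRing_iff_of_sectionsEquiv`) at `I := JordanFive.I12` (p523816); NOT a statement of
any manuscript; replaces the role of no printed item.)

TERM-INDEPENDENT HALF of the W-side package: the opens `W₁` (μ₃ twisted chart, res-L1-w45c-stub-1)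
and `W₂` (μ₂-HIGH open, res-L1-w45c-idea-2 / tri-1 design) of the scaffold are to be basic opens
`D₊(s)` of `Proj k[x][I₁₂ t] = Bl_{I₁₂} 𝔸ⁿ` at homogeneous Rees sections `s = r·tᵐ` (`m ≥ 1`) with
`σ`-INVARIANT `r`. For every such `s` this file gives, with the `I₁₂`-stability of `σ` as a
hypothesis `hI : ∀ g : ⟨σ⟩, g • I₁₂ = I₁₂` (res-L1-w45c-lead-1's frame `map_I12_eq`, by name):
* `JordanFive.exists_reesGradedHom_family_I12` — the coefficientwise `φ g` (`g⁻¹` on coefficients,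
  `Proj.map` hypothesis) fixing every invariant monomial section, with the powers clause `hP`;
* `JordanFive.preimage_basicOpen_liftAction_I12` — **`HW·st`**: `(ρ♯ g)⁻¹ D₊(s) = D₊(s)` for the
  lifted action of ANY `ρ` with the affine-quotient law (binder shape of `J5Bricks.lean` l.96–104);
* `JordanFive.isAffineOpen_basicOpen_I12` — **`HW·aff`**;
* `JordanFive.exists_sectionsEquiv_basicOpen_I12` — **the SEAM** at a stable affine open `O` of an
  `ActionOver (π ≫ q)` with `O.1 = D₊(s)` (binders `ρ hρ ρB haut O hO` as in `HP₁`/`HP₂`,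
  l.120–131): `Ω : (k[x][I₁₂t])_{(s)} ≃+* Γ(↥O.1, (O.1.ι ≫ π ≫ q)⁻¹ ⊤)` with (o) the coefficient
  law of `φ`, (i) `Ω (f/1) = (O.1.ι ≫ π)^* f`, (ii) `act g (Ω y) = Ω (φ_{g⁻¹} y)`, (iii)
  `Ω y ∈ invariantsRing ⊤ ↔ ∀ g, φ_g y = y`.
`W₁`/`W₂` plug in by name with two facts each (`s ∈ reesGrading I₁₂ m`, `↑s = monomial m r` with
`g • r = r`).
-/

-- single-problem summit: the doubled namespace component `ResolutionOfSingularities` is forced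
set_option linter.dupNamespace false

noncomputable section

open CategoryTheory AlgebraicGeometry TopologicalSpace MvPolynomial Polynomial HomogeneousLocalization
open Literature.AlgebraicGeometry.Resolution Literature.AlgebraicGeometry.RelativeSpec
open scoped Pointwise

namespace Summit.ResolutionOfSingularities.ResolutionOfSingularities.Theorems.WildQuotientResolution.JordanFive

variable (k : Type) [Field k] (n : ℕ) (σ : MvPolynomial (Fin n) k ≃ₐ[k] MvPolynomial (Fin n) k)
  (a b c d : Fin n)

/-- `k[x] → Γ(Spec k[x], ⊤)` (local shorthand) -/
local notation3 "ι₀" => (Scheme.ΓSpecIso (CommRingCat.of (MvPolynomial (Fin n) k))).inv.hom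
/-- the quotient map `q : 𝔸ⁿ → 𝔸ⁿ/⟨σ⟩` (local shorthand) -/
local notation3 "qσ" => Spec.map (CommRingCat.ofHom (algebraMap
  (FixedPoints.subalgebra k (MvPolynomial (Fin n) k) (Subgroup.zpowers σ)) (MvPolynomial (Fin n) k)))

/-! ## The `φ`-family for `I₁₂` -/

/-- **The `φ`-family for `I₁₂`.** If `I₁₂` is stable under `⟨σ⟩` (`hI`), there are graded ring
endomorphisms `φ g` of `k[x][I₁₂ t]` acting by `g⁻¹` on coefficients, with the `Proj.map` hypothesis,
FIXING every homogeneous section `s = r tᵐ` with `σ`-invariant `r` and mapping the powers of such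
`s` into themselves. [OURS · L1 W4.5c] [folklore; assembly of landed decls] -/
theorem exists_reesGradedHom_family_I12
    (hI : ∀ g : ↥(Subgroup.zpowers σ), g • I12 k n a b c d = I12 k n a b c d) :
    ∃ φ : ↥(Subgroup.zpowers σ) → (reesGrading (I12 k n a b c d) →+*ᵍ reesGrading (I12 k n a b c d)),
      (∀ (g : ↥(Subgroup.zpowers σ)) x, ((φ g x : reesAlgebra (I12 k n a b c d)) :
          (MvPolynomial (Fin n) k)[X]) =
        (x : (MvPolynomial (Fin n) k)[X]).map ((MulSemiringAction.toRingEquiv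
          (↥(Subgroup.zpowers σ)) (MvPolynomial (Fin n) k) g⁻¹ : _ ≃+* _) : _ →+* _)) ∧
      (∀ g, HomogeneousIdeal.irrelevant (reesGrading (I12 k n a b c d)) ≤
        (HomogeneousIdeal.irrelevant (reesGrading (I12 k n a b c d))).map (φ g)) ∧
      (∀ (s : reesAlgebra (I12 k n a b c d)) (m : ℕ) (r : MvPolynomial (Fin n) k),
        ((s : (MvPolynomial (Fin n) k)[X]) = monomial m r) →
        (∀ g : ↥(Subgroup.zpowers σ), g • r = r) →
        ∀ g, φ g s = s ∧ Submonoid.powers s ≤ (Submonoid.powers s).comap (φ g)) := by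
  obtain ⟨φ, hφ, hf⟩ := BlowupExit.exists_reesGradedHom_family (I := I12 k n a b c d) hI
  refine ⟨φ, hφ, hf, fun s m r hsr hr g => ?_⟩
  have hτ : ((MulSemiringAction.toRingEquiv (↥(Subgroup.zpowers σ)) (MvPolynomial (Fin n) k) g⁻¹ :
      _ ≃+* _) : _ →+* _) r = r := by
    change (MulSemiringAction.toRingEquiv _ _ g⁻¹) r = r
    rw [MulSemiringAction.toRingEquiv_apply_apply, hr]
  exact ⟨BlowupExit.reesGradedHom_eq_self_of_monomial s r hsr (φ g) _ (hφ g) hτ,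
    BlowupExit.powers_le_comap_of_monomial s r hsr (φ g) _ (hφ g) hτ⟩

/-! ## `HW·st` and `HW·aff` for an invariant basic open -/

/-- **`HW·st` for any invariant Rees chart**: for ANY `ρ` with the affine-quotient law and any proof
`hJρ` that the ideal sheaf of `I₁₂` is `ρ`-stable, the lifted action on `Bl_{I₁₂} 𝔸ⁿ` preserves
`D₊(r tᵐ)` whenever `r` is `σ`-invariant (binder shape of `HW₁st`/`HW₂st`, `J5Bricks.lean`
l.96–110, at `W := D₊(s)`). [OURS · L1 W4.5c] [folklore; assembly of landed decls] -/
theorem preimage_basicOpen_liftAction_I12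
    (hI : ∀ g : ↥(Subgroup.zpowers σ), g • I12 k n a b c d = I12 k n a b c d)
    (s : reesAlgebra (I12 k n a b c d)) {m : ℕ} {r : MvPolynomial (Fin n) k}
    (hsr : (s : (MvPolynomial (Fin n) k)[X]) = monomial m r)
    (hr : ∀ g : ↥(Subgroup.zpowers σ), g • r = r)
    (ρ : ↥(Subgroup.zpowers σ) →* Aut (Spec (CommRingCat.of (MvPolynomial (Fin n) k))))
    (hρ : ∀ g : ↥(Subgroup.zpowers σ), (ρ g).hom = Spec.map (CommRingCat.ofHom
      ((MulSemiringAction.toRingEquiv (↥(Subgroup.zpowers σ)) (MvPolynomial (Fin n) k) g⁻¹ :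
        MvPolynomial (Fin n) k ≃+* MvPolynomial (Fin n) k) :
          MvPolynomial (Fin n) k →+* MvPolynomial (Fin n) k)))
    (hJρ : ∀ g : ↥(Subgroup.zpowers σ),
      (affineBlowup.idealSheaf (I12 k n a b c d)).comap (ρ g).hom =
        affineBlowup.idealSheaf (I12 k n a b c d))
    (g : ↥(Subgroup.zpowers σ)) :
    (((affineBlowup.isBlowup (I12 k n a b c d)).liftAction ρ hJρ) g).hom ⁻¹ᵁ
        Proj.basicOpen (reesGrading (I12 k n a b c d)) s =
      Proj.basicOpen (reesGrading (I12 k n a b c d)) s :=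
  ToricExit.preimage_basicOpen_liftAction_of_monomial ρ hρ hJρ g hI s hsr hr

/-- **`HW·aff`**: a Rees chart `D₊(s)` of positive degree is an affine open of `Bl_{I₁₂} 𝔸ⁿ`
(Mathlib `Proj.isAffineOpen_basicOpen`). [OURS · L1 W4.5c] -/
theorem isAffineOpen_basicOpen_I12 (s : reesAlgebra (I12 k n a b c d)) {m : ℕ}
    (hs : s ∈ reesGrading (I12 k n a b c d) m) (hm : 0 < m) :
    IsAffineOpen (Proj.basicOpen (reesGrading (I12 k n a b c d)) s) :=
  Proj.isAffineOpen_basicOpen _ _ hs hm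

/-! ## The seam at an invariant basic open -/

-- the literal `ActionOver` binder terms are large: head-room for the statement
set_option maxHeartbeats 4000000 in
/-- **THE SEAM for RUNG V5 at any invariant Rees chart.** For a stable affine open `O` of an
`ActionOver (π ≫ q)` whose automorphisms are the lifted `ρ♯` (`haut`) with `O.1 = D₊(s)`,
`s = r tᵐ`, `m ≥ 1`, `r` invariant: the `φ`-family, its powers clause, and
`Ω : (k[x][I₁₂t])_{(s)} ≃+* Γ(↥O.1, (O.1.ι ≫ π ≫ q)⁻¹ ⊤)` with (o) the coefficient law,
(i) `Ω (f/1) = (O.1.ι ≫ π)^* f`, (ii) `act g (Ω y) = Ω (φ_{g⁻¹} y)`, (iii)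
`Ω y ∈ invariantsRing ⊤ ↔ ∀ g, φ_g y = y` — so a ring brick on `O` reduces to algebra in the
homogeneous localisation (V4U `H₀`/`H₁` pattern). [OURS · L1 W4.5c] [folklore; assembly of landed
decls] -/
theorem exists_sectionsEquiv_basicOpen_I12
    (hI : ∀ g : ↥(Subgroup.zpowers σ), g • I12 k n a b c d = I12 k n a b c d)
    (s : reesAlgebra (I12 k n a b c d)) {m : ℕ} (hs : s ∈ reesGrading (I12 k n a b c d) m)
    (hm : 0 < m) {r : MvPolynomial (Fin n) k}
    (hsr : (s : (MvPolynomial (Fin n) k)[X]) = monomial m r)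
    (hr : ∀ g : ↥(Subgroup.zpowers σ), g • r = r)
    (ρ : ↥(Subgroup.zpowers σ) →* Aut (Spec (CommRingCat.of (MvPolynomial (Fin n) k))))
    (hρ : ∀ g : ↥(Subgroup.zpowers σ), (ρ g).hom = Spec.map (CommRingCat.ofHom
      ((MulSemiringAction.toRingEquiv (↥(Subgroup.zpowers σ)) (MvPolynomial (Fin n) k) g⁻¹ :
        MvPolynomial (Fin n) k ≃+* MvPolynomial (Fin n) k) :
          MvPolynomial (Fin n) k →+* MvPolynomial (Fin n) k)))
    (hJρ : ∀ g : ↥(Subgroup.zpowers σ),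
      (affineBlowup.idealSheaf (I12 k n a b c d)).comap (ρ g).hom =
        affineBlowup.idealSheaf (I12 k n a b c d))
    (ρB : ActionOver (affineBlowup.π (I12 k n a b c d) ≫ qσ) ↥(Subgroup.zpowers σ))
    (haut : ρB.aut = (affineBlowup.isBlowup (I12 k n a b c d)).liftAction ρ hJρ)
    (O : ρB.StableAffineOpens) (hO : O.1 = Proj.basicOpen (reesGrading (I12 k n a b c d)) s) :
    ∃ (φ : ↥(Subgroup.zpowers σ) → (reesGrading (I12 k n a b c d) →+*ᵍ reesGrading (I12 k n a b c d)))
      (hP : ∀ g, Submonoid.powers s ≤ (Submonoid.powers s).comap (φ g))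
      (Ω : HomogeneousLocalization.Away (reesGrading (I12 k n a b c d)) s ≃+*
        Γ((O.1 : Scheme.{0}), (O.1.ι ≫ affineBlowup.π (I12 k n a b c d) ≫ qσ) ⁻¹ᵁ ⊤)),
      (∀ (g : ↥(Subgroup.zpowers σ)) x, ((φ g x : reesAlgebra (I12 k n a b c d)) :
          (MvPolynomial (Fin n) k)[X]) =
        (x : (MvPolynomial (Fin n) k)[X]).map ((MulSemiringAction.toRingEquiv
          (↥(Subgroup.zpowers σ)) (MvPolynomial (Fin n) k) g⁻¹ : _ ≃+* _) : _ →+* _)) ∧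
      (∀ f : MvPolynomial (Fin n) k,
        Ω (((fromZeroRingHom (reesGrading (I12 k n a b c d)) (.powers s)).comp
          (reesGrading.zeroRingHom (I12 k n a b c d))) f) =
        (O.1.ι ≫ affineBlowup.π (I12 k n a b c d)).appLE ⊤
          ((O.1.ι ≫ affineBlowup.π (I12 k n a b c d) ≫ qσ) ⁻¹ᵁ ⊤) le_top (ι₀ f)) ∧
      (∀ (g : ↥(Subgroup.zpowers σ)) y, (ρB.restrict O.1 O.2.1).act g ⊤ (Ω y) =
        Ω (HomogeneousLocalization.map (φ g⁻¹) (hP g⁻¹) y)) ∧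
      (∀ y, Ω y ∈ (ρB.restrict O.1 O.2.1).invariantsRing ⊤ ↔
        ∀ g, HomogeneousLocalization.map (φ g) (hP g) y = y) := by
  have H := exists_reesGradedHom_family_I12 k n σ a b c d hI
  rcases H with ⟨φ, hφ, hf, hfix⟩
  have hφs : ∀ g, φ g s = s := fun g => (hfix s m r hsr hr g).1
  have hP : ∀ g, Submonoid.powers s ≤ (Submonoid.powers s).comap (φ g) :=
    fun g => (hfix s m r hsr hr g).2
  have H2 := BlowupExit.exists_basicOpen_sectionsEquiv ρ hρ hJρ qσ ρB (fun g => by rw [haut])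
    s hs hm φ hφ hf hφs hP O.1 O.2.1 hO
  rcases H2 with ⟨Ω, hΩi, hΩii⟩
  exact ⟨φ, hP, Ω, hφ, hΩi, hΩii, fun y =>
    BlowupExit.mem_invariantsRing_iff_of_sectionsEquiv qσ ρB _ φ hP O.1 O.2.1 Ω hΩii y⟩

end Summit.ResolutionOfSingularities.ResolutionOfSingularities.Theorems.WildQuotientResolution.JordanFive

end
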